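import Summits.RiemannHypothesis.RiemannHypothesis.Theorems.Splittings.BombieriTruncGram

/-!
# Splittings — x-wuc (xiv-c1, optional): crude off-line Bessel constant and `FOZ → NegSpecBounded E` (Bombieri §10 (U2), RH-free)

Cell rh-split, seat rh-split-x-wuc g5 (brief sha16 f79c5f09d8bcb036), card `run/shared/lean/pub/rh-split/cards/SPLIT-x-wuc.md` §11
(referee rh-split-ref g3 2026-08-27T06:23:10Z: REPLAY PASS of the scratch `HOME/rh-split-x-wuc/SplitXWucG5.lean`; lead RULING #35:
cut (xiv)).  Carved VERBATIM from that scratch (file of record sha16 66b013c38c58c722); sections as numbered there.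
* §3 `offCount`, `offGramBound_crude`, `negEig_re_ge_crude` (`−e^a · J_N · |E| ≤ μ`), `NegSpecBounded`, `negSpecBounded_of_foz`.  UNCONDITIONAL lemmas +
  one FOZ-conditional corollary (hypothesis position).
HONEST LABEL: «SPLITTING SEARCH over kernel-typed RH-EQUIVALENCES; a splitting A ∧ B ⟹ RH is CONDITIONAL bookkeeping
unless A and B are both proved; nothing here bears on the truth of RH.»
-/

set_option linter.dupNamespace false

noncomputable section

open scoped Classical ComplexConjugate
open Set Filter Topology Complex MeasureTheory

namespace Summit.RiemannHypothesis.RiemannHypothesis.Theorems.Splittings.BombieriTruncNegSpecBounded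

open Literature.NumberTheory.LFunctions Literature.NumberTheory.LFunctions.Bombieri2000
open Summit.RiemannHypothesis.RiemannHypothesis.Theses.RuelleBand
open Summit.RiemannHypothesis.RiemannHypothesis.Theorems.Splittings.BombieriTruncEigen
open Summit.RiemannHypothesis.RiemannHypothesis.Theorems.Splittings.BombieriFozNoDep
open Summit.RiemannHypothesis.RiemannHypothesis.Theorems.Splittings.BombieriTruncGram

variable {E : Set ℝ} {N : ℕ}

/-! ## §3 (K1a) The crude off-line Bessel bound `e^{a}·|E|·J_N` and FOZ ⟹ uniformly bounded negative spectra -/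

/-- `J_N`: the number of off-line slots in `Γ_N`. -/
def offCount (N : ℕ) : ℕ := (Finset.univ.filter fun i : truncIdx N ↦ (i : ZeroIdx).OffLine).card

/-- `|e^{−iγu}| ≤ e^{a/2}` on `E ⊆ [−a, a]` (`|Im γ| < 1/2`). -/
theorem norm_cexp_le {a : ℝ} (hE : E ⊆ Icc (-a) a) (i : ZeroIdx) {u : ℝ} (hu : u ∈ E) :
    ‖cexp (-(I * i.gamma * u))‖ ≤ Real.exp (a / 2) := by
  rw [Complex.norm_exp]
  apply Real.exp_le_exp.2
  have hre : (-(I * i.gamma * u)).re = i.gamma.im * u := by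
    simp [Complex.mul_re, Complex.mul_im]
  have hu' := hE hu
  have h1 := i.re_pos_and_lt_one
  rw [hre, gamma_im]
  nlinarith [mul_nonneg h1.1.le (by linarith [hu'.1] : 0 ≤ a + u),
    mul_nonneg (by linarith [h1.2] : 0 ≤ 1 - i.val.re) (by linarith [hu'.2] : 0 ≤ a - u)]

/-- Pointwise: `|F_x(u)|² ≤ e^{a} J_N Σ|x_γ|²` for `x` supported off-line and `u ∈ E`. -/
theorem norm_F_sq_le {a : ℝ} (hE : E ⊆ Icc (-a) a) (x : truncIdx N → ℂ)
    (hx : ∀ i : truncIdx N, ¬ (i : ZeroIdx).OffLine → x i = 0) {u : ℝ} (hu : u ∈ E) :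
    ‖F N x u‖ ^ 2 ≤ Real.exp a * offCount N * ∑ i, ‖x i‖ ^ 2 := by
  set P : truncIdx N → Prop := fun i ↦ (i : ZeroIdx).OffLine with hPdef
  have hsum : F N x u = ∑ j ∈ Finset.univ.filter P, x j * cexp (-(I * (j : ZeroIdx).gamma * u)) := by
    rw [F, ← Finset.sum_filter_add_sum_filter_not Finset.univ P]
    have h2 : ∑ j ∈ Finset.univ.filter (fun j ↦ ¬ P j), x j * cexp (-(I * (j : ZeroIdx).gamma * u)) = 0 :=
      Finset.sum_eq_zero fun j hj ↦ by rw [hx j (Finset.mem_filter.1 hj).2, zero_mul]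
    rw [h2, add_zero]
  have hbound : ‖F N x u‖ ≤ Real.exp (a / 2) * ∑ j ∈ Finset.univ.filter P, ‖x j‖ := by
    rw [hsum, Finset.mul_sum]
    refine (norm_sum_le _ _).trans (Finset.sum_le_sum fun j _ ↦ ?_)
    rw [norm_mul, mul_comm]
    exact mul_le_mul_of_nonneg_right (norm_cexp_le hE _ hu) (norm_nonneg _)
  have hCS : (∑ j ∈ Finset.univ.filter P, ‖x j‖) ^ 2 ≤ offCount N * ∑ j ∈ Finset.univ.filter P, ‖x j‖ ^ 2 := by
    have := sq_sum_le_card_mul_sum_sq (s := Finset.univ.filter P) (f := fun j ↦ ‖x j‖)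
    simpa [offCount, hPdef] using this
  have hsub : ∑ j ∈ Finset.univ.filter P, ‖x j‖ ^ 2 ≤ ∑ i, ‖x i‖ ^ 2 :=
    Finset.sum_le_sum_of_subset_of_nonneg (Finset.filter_subset _ _) fun i _ _ ↦ by positivity
  have hexp : Real.exp (a / 2) ^ 2 = Real.exp a := by rw [← Real.exp_nat_mul]; ring_nf
  have hn : 0 ≤ ∑ j ∈ Finset.univ.filter P, ‖x j‖ := Finset.sum_nonneg fun j _ ↦ norm_nonneg _
  calc ‖F N x u‖ ^ 2 ≤ (Real.exp (a / 2) * ∑ j ∈ Finset.univ.filter P, ‖x j‖) ^ 2 :=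
        pow_le_pow_left₀ (norm_nonneg _) hbound 2
    _ = Real.exp a * (∑ j ∈ Finset.univ.filter P, ‖x j‖) ^ 2 := by rw [mul_pow, hexp]
    _ ≤ Real.exp a * (offCount N * ∑ j ∈ Finset.univ.filter P, ‖x j‖ ^ 2) :=
        mul_le_mul_of_nonneg_left hCS (Real.exp_nonneg _)
    _ ≤ Real.exp a * offCount N * ∑ i, ‖x i‖ ^ 2 := by
        rw [mul_assoc]
        exact mul_le_mul_of_nonneg_left (mul_le_mul_of_nonneg_left hsub (Nat.cast_nonneg _)) (Real.exp_nonneg _)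

/-- **(K1a) kernel: the crude off-line Bessel bound.** `‖F_x‖²_{L²(E)} ≤ e^{a} · |E| · J_N · Σ|x_γ|²` for `x` supported
on the off-line slots of `Γ_N` — Bombieri's (U2) `|λ_N| ≤ √(2J)·max|K_E|` with an explicit constant. -/
theorem offGramBound_crude {a : ℝ} (hE : E ⊆ Icc (-a) a) (N : ℕ) :
    OffGramBound E N (Real.exp a * offCount N * volume.real E) := by
  intro x hx
  have hfin : volume E < ⊤ := (measure_mono hE).trans_lt measure_Icc_lt_top
  have h := norm_setIntegral_le_of_norm_le_const hfin (f := fun u ↦ ‖F N x u‖ ^ 2)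
    (C := Real.exp a * offCount N * ∑ i, ‖x i‖ ^ 2) fun u hu ↦ by
      rw [Real.norm_of_nonneg (by positivity)]
      exact norm_F_sq_le hE x hx hu
  have h0 : 0 ≤ ∫ u in E, ‖F N x u‖ ^ 2 := integral_nonneg fun u ↦ by positivity
  rw [Real.norm_of_nonneg h0] at h
  calc ∫ u in E, ‖F N x u‖ ^ 2 ≤ Real.exp a * offCount N * (∑ i, ‖x i‖ ^ 2) * volume.real E := h
    _ = Real.exp a * offCount N * volume.real E * ∑ i, ‖x i‖ ^ 2 := by ring

/-- **(K1a) every negative eigenvalue of `𝒦_E(Γ_N)` satisfies `−e^{a}·|E|·J_N ≤ μ`.** -/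
theorem negEig_re_ge_crude {a : ℝ} (hE : E ⊆ Icc (-a) a) {μ : ℂ} (hμ : μ ∈ (truncKMat E N).charpoly.roots)
    (him : μ.im = 0) (hre : μ.re < 0) : -(Real.exp a * offCount N * volume.real E) ≤ μ.re := by
  obtain ⟨w, hw0, hw⟩ := Literature.Analysis.InnerProduct.exists_mulVec_eq_smul_of_mem_roots_charpoly hμ
  -- normalise
  obtain ⟨i₀, hi₀⟩ : ∃ i, w i ≠ 0 := by
    by_contra h
    push Not at h
    exact hw0 (funext h)
  set s : ℝ := ∑ i, ‖w i‖ ^ 2 with hs_def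
  have hs : 0 < s := by
    have h1 : ‖w i₀‖ ^ 2 ≤ s :=
      Finset.single_le_sum (f := fun i ↦ ‖w i‖ ^ 2) (fun i _ ↦ by positivity) (Finset.mem_univ i₀)
    have h2 : 0 < ‖w i₀‖ ^ 2 := pow_pos (norm_pos_iff.2 hi₀) 2
    linarith
  set c : ℂ := (((Real.sqrt s : ℝ) : ℂ))⁻¹ with hc_def
  have hv : (truncKMat E N).mulVec (c • w) = μ • (c • w) := by
    rw [Matrix.mulVec_smul, hw, smul_comm]
  have hnorm : ∑ i, ‖(c • w) i‖ ^ 2 = 1 := by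
    have hsq : ∀ i, ‖(c • w) i‖ ^ 2 = s⁻¹ * ‖w i‖ ^ 2 := by
      intro i
      rw [Pi.smul_apply, smul_eq_mul, norm_mul, hc_def, norm_inv, Complex.norm_real,
        Real.norm_of_nonneg (Real.sqrt_nonneg s), mul_pow, inv_pow, Real.sq_sqrt hs.le]
    simp_rw [hsq, ← Finset.mul_sum]
    exact inv_mul_cancel₀ hs.ne'
  exact negEig_re_ge_of_offGramBound' hE him hre hv hnorm (by positivity) (offGramBound_crude hE N)

/-- (U2, uniform form; verbatim g4's `NegSpecBounded`) the negative spectra of all truncations are bounded below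
uniformly in `N`. -/
def NegSpecBounded (E : Set ℝ) : Prop :=
  ∃ C : ℝ, ∀ N : ℕ, ∀ μ : ℂ, μ ∈ (truncKMat E N).charpoly.roots → μ.im = 0 → μ.re < 0 → -C ≤ μ.re

/-- Under FOZ the off-line slot counts `J_N` are bounded uniformly in `N`. -/
theorem offCount_le_of_cofiniteCriticalLine (h : CofiniteCriticalLine) :
    ∃ J : ℕ, ∀ N, offCount N ≤ J := by
  have hfin : {ρ : ℂ | ρ ∈ ZetaZeros.riemannZetaNontrivialZeros ∧ ρ.re ≠ 1 / 2}.Finite :=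
    cofiniteCriticalLine_iff_foz.1 h
  obtain ⟨M, hM⟩ := (hfin.image fun ρ : ℂ ↦ ‖ρ - 1 / 2‖).bddAbove
  refine ⟨(ZeroIdx.trunc_finite M).toFinset.card, fun N ↦ ?_⟩
  rw [offCount]
  refine Finset.card_le_card_of_injOn (fun i : truncIdx N ↦ (i : ZeroIdx)) (fun i hi ↦ ?_)
    (Set.injOn_of_injective Subtype.val_injective)
  have hoff : (i : ZeroIdx).OffLine := (Finset.mem_filter.1 (Finset.mem_coe.1 hi)).2
  simp only [Set.Finite.coe_toFinset, ZeroIdx.trunc, Set.mem_setOf_eq]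
  exact hM ⟨(i : ZeroIdx).val, ⟨(i : ZeroIdx).val_mem, hoff⟩, rfl⟩

/-- **FOZ ⟹ (U2)** on every bounded window, RH-free (g4 had (U2) only under RH, vacuously): with finitely many
off-line zeros the crude Bessel constants `e^{a}|E|J_N` are bounded. [new-in-kernel; Bombieri2000Weil §10 (U2)] -/
theorem negSpecBounded_of_foz (h : CofiniteCriticalLine) {a : ℝ} (hE : E ⊆ Icc (-a) a) : NegSpecBounded E := by
  obtain ⟨J, hJ⟩ := offCount_le_of_cofiniteCriticalLine h
  refine ⟨Real.exp a * J * volume.real E, fun N μ hμ him hre ↦ ?_⟩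
  have h1 := negEig_re_ge_crude hE hμ him hre
  have h2 : Real.exp a * offCount N * volume.real E ≤ Real.exp a * J * volume.real E :=
    mul_le_mul_of_nonneg_right (mul_le_mul_of_nonneg_left (Nat.cast_le.2 (hJ N)) (Real.exp_nonneg _))
      measureReal_nonneg
  linarith

end Summit.RiemannHypothesis.RiemannHypothesis.Theorems.Splittings.BombieriTruncNegSpecBounded
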